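import Summits.CriticalPhenomena.PercolationContinuityZ3.Theorems.Transplant.SkelFrm1ChoiceDefs
import Summits.CriticalPhenomena.PercolationContinuityZ3.Theorems.Transplant.SkelFrmBParamsLOA
import Summits.CriticalPhenomena.PercolationContinuityZ3.Theorems.Transplant.SkelFrm1ParamsLBL
import Summits.CriticalPhenomena.PercolationContinuityZ3.Theorems.Transplant.SkelPhiCellsSmallMS
import Summits.CriticalPhenomena.PercolationContinuityZ3.Theorems.Transplant.SkelPhiConcScheduleN
import HarnessLib

/-!
# N2 (frames-only node `SamePDropOfSkeletonFrm₁`, OPEN), WAVE 1: THE CHOICE FUNCTION OF RECORD OVER `Frm` / `DataNS` / STAGGERED CELLS `PCells2S` —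
# `PlanarSkeletonFrm.frmChoiceAllQ gv fv Pv Sv cv bv : ChoiceFnNQ` (definitions only; ruling (R-31))

The N2 twin of N1's choice function of the (ζ′) chain `PlanarSkeletonNeg.negChoiceAllOTA` (SkelNegBChoiceAllTA §1), targeting p3-g15's choice layer over the record
WITH selectors (`PlanarSkeletonFrm.ChoiceNQ` / `AtQNQ` / `ChoiceFnNQ` / `GeomHoldsNQFn`, SkelFrm1ChoiceDefs), with the cells of record the K-G STAGGERED cells
`PCells2S` ((R-22): `cenS v j = 20 r_j v_j + c_{oth j} v_{oth j}`, PlanarCells2SDefs) and the scheme geometry hp-8 g40's `Skelφ.cellGeomSG₂bS / faceDataSGS /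
levelDataSS` (SkelPhiCellsSmallMS / SkelPhiCellsWeakGLevelsS).  ONE clean chain (no OF/OP/OB/OS/OT history): SIX slots (ruling (R-31), p3-g15 2026-08-23T00:35:58Z) —
box `gv`, width `fv`, extra pairs `Pv`, fibre block `Sv` (N1's four, SkelFrm1SlotTypes), the creep slot `cv` (creep per axis in fine cells, value of record ≈ 2 b⊥ + 3 hops
≈ 0.6 r, `cmax := r`, (R-22); closed later by a one-line `NegB.cR` with its floor lemma, exactly as N1 closed `fR/SR`) and the ARRIVAL-BOX slot `bv` (half-widths in fine
cells: under (R-22) the arrival box is the K-G corridor's last core, `kgCorrSched_core_last_subset`, so N1's `b0TA = r/4` is NOT hard-coded; ledger rows `10·u_i ≤ b_i ≤ 3·r_i`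
and 'last core ⊆ Mb b (x+du)', FRM-PARAMS (r13-15)).
* §1 `NegB.CSlot`, `NegB.BSlot`; the TOTAL staggered cells **`NegB.fcellsS κ Φ t p D g f c : PCells2S`** (`toPCells2 := fcellsA`, creep truncated at `ccap := min (max c₀ c₁)
  (min r₀ r₁)` so that the record's three proof fields hold for EVERY slot value; under the ledger row `c i ≤ r j` the truncation is the identity, `fcellsS_c_eq`;
  `fcellsS_cmax_le`); the truncated arrival half-widths **`NegB.bS b i := min (b i) (3 r_i)`** (`bS_le : bS ≤ 3r` always — SmallMS's `Mb_subset_M` row; `bS_eq` under the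
  ledger row `b_i ≤ 3 r_i`);
* §2 the column slot read at the STAGGERED centre **`NegB.offNS x := NrepA (cenS x) + 1`** (= hp-8's `hcolQ` row), the schedule **`NegB.schedOfS S := Prm.schedN S fcellsA offNS`**
  (numbers over the underlying `PCells2`; no twin of `SkelPhiConcScheduleN` needed), `schedOfS_WFS2`, `colQ_schedOfS`;
* §3 the slot readings `gOf/fOf/cOf/bOf` at the merged record, the scheme / face data / level data of record **`ΓQ / FDQ / LDQ`** at `(O, q)`, the choices
  **`NegB.choiceAtQ : ChoiceNQ κ Φ t p hC`**, the choice function **`frmChoiceAllQ gv fv Pv Sv cv bv : ChoiceFnNQ`**, `frmChoiceAllQ_eq` / `_scheme` (rfl); `SMnP`;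
  the `rfl` API of the scheme of record `ΓQ_root/_a₀/_K/_M/_Q/_Efar/_anchSet` (what the residue wrappers and the ROOM files read without unfolding).
The Geom wrapper `geomHoldsNQFn_frmChoiceAllQ` is the companion `SkelFrmBChoiceGeom`; the (R)/(F)/(C) wrappers are p3 / hp-8 / p5's over the same `frmChoiceAllQ`.
builds on p205010 (kernel theorem, internal audit signed; external expert review pending) — nothing in this file uses p205010; NOTHING is claimed about the open node
`SamePDropOfSkeletonFrm₁` (`SamePDropOfSkeletonNeg₁` is CLOSED in the tree and untouched by this file).
Lane `prim-bschramm`, seat `prim-bschramm-stmt` (gen 20); helper file (`--supports stmt-CriticalPhenomena-4575 --as helper`); ledger HOME/prim-bschramm-stmt/FRM-PARAMS.md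
(r13-14)/(r13-15) (creep/cube slots); shape (Q-CF1) 2026-08-23T00:29Z, RULED (R-31) by the design owner p3-g15 00:35:58Z (slot set, truncation device, names).
[cite: KozmaNitzan2024, §4 Theorem 6 (pp. 25–31): the order of constants; pp. 25–27 (Q_v, M_v, E_{v,x}, H^j_{v,x})] [cite: MartineauTassion2017, §3.2 Lemma 3.5, §4.3]
-/

noncomputable section

open scoped Classical

namespace Summit.CriticalPhenomena.PercolationContinuityZ3.Theorems.Transplant

open MeasureTheory Literature.Probability.Percolation Literature.Probability.LatticeModels SimpleGraph KNCells
open Literature.Barriers.CriticalPhenomena (HasExponentialGrowth)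

namespace PlanarSkeletonFrm

open SkelConc (Consts)
open BoxProdZ2 (ConcRadiiG)
open Skelφ (oriφ trφ)
open Skelφ.StepI (DataN DataNS OutNS)

namespace NegB

open Neg

/-! ## §1 The creep slot and the staggered cells of record -/

/-- **A creep slot over `Frm`**: the creep per axis, in fine cells, as a function of everything p-fixed (constants, skeleton, base vertex, density, merged record WITH
selectors, box and width values). [this work] -/
def CSlot : Type 1 :=
  ∀ (κ : Consts) {V : Type} [DecidableEq V] [Countable V] {G : SimpleGraph V} [G.LocallyFinite],
    PlanarSkeletonFrm G → V → unitInterval → Skelφ.StepI.DataNS V → ℕ → ℕ → Fin 2 → ℕ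

/-- The zero creep (sanity value: `fcellsS … 0` is `fcellsA` with `c = 0`). [this work] -/
def CSlot.zero : CSlot := fun _ _ _ _ _ _ _ _ _ _ _ _ _ => 0

/-- **An arrival-box slot over `Frm`**: the arrival half-widths per axis, in fine cells (the K-G corridor's last core must sit inside `Mb b (x+du)` about `cenS (x+du)`;
ledger rows `10·u_i ≤ b_i ≤ 3·r_i`), as a function of the same data as the creep. [this work] -/
def BSlot : Type 1 :=
  ∀ (κ : Consts) {V : Type} [DecidableEq V] [Countable V] {G : SimpleGraph V} [G.LocallyFinite],
    PlanarSkeletonFrm G → V → unitInterval → Skelφ.StepI.DataNS V → ℕ → ℕ → Fin 2 → ℕ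

/-- N1's arrival half-widths as a slot value (sanity value `b i := r i / 4 = 10·Kq` strides, `b0TA`; NOT the value of record under (R-22)). [this work] -/
def BSlot.quarter : BSlot := fun κ _ _ _ _ _ Φ t p D g f i => (fcellsA κ Φ t p D g f).r i / 4

section Values

variable (κ : Consts) {V : Type} [DecidableEq V] [Countable V] {G : SimpleGraph V} [G.LocallyFinite] (Φ : PlanarSkeletonFrm G) (t : V)
  (p : unitInterval) (D : DataNS V) (g f : ℕ) (c : Fin 2 → ℕ)

/-- **The creep cap** `ccap := min (max c₀ c₁) (min r₀ r₁)` (so that `c_i ≤ ccap ≤ r_j` can be enforced by truncation). [this work] -/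
def ccap : ℕ := min (max (c 0) (c 1)) (min ((fcellsA κ Φ t p D g f).r 0) ((fcellsA κ Φ t p D g f).r 1))

/-- **The truncated creep** `cS i := min (c i) ccap`. [this work] -/
def cS (i : Fin 2) : ℕ := min (c i) (ccap κ Φ t p D g f c)

/-- `ccap ≤ r j`. [folklore] -/
theorem ccap_le_r (j : Fin 2) : ccap κ Φ t p D g f c ≤ (fcellsA κ Φ t p D g f).r j := by
  have h : ccap κ Φ t p D g f c ≤ min ((fcellsA κ Φ t p D g f).r 0) ((fcellsA κ Φ t p D g f).r 1) := min_le_right _ _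
  fin_cases j
  · exact h.trans (min_le_left _ _)
  · exact h.trans (min_le_right _ _)

/-- `cS i ≤ ccap` and `cS i ≤ c i`. [folklore] -/
theorem cS_le (i : Fin 2) : cS κ Φ t p D g f c i ≤ ccap κ Φ t p D g f c ∧ cS κ Φ t p D g f c i ≤ c i := ⟨min_le_right _ _, min_le_left _ _⟩

/-- **Under the ledger row `c i ≤ r j` (all `i, j`) the truncation is the identity**: `cS i = c i`. [folklore] -/
theorem cS_eq (h : ∀ i j, c i ≤ (fcellsA κ Φ t p D g f).r j) (i : Fin 2) : cS κ Φ t p D g f c i = c i := by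
  have hmax : max (c 0) (c 1) ≤ min ((fcellsA κ Φ t p D g f).r 0) ((fcellsA κ Φ t p D g f).r 1) :=
    le_min (max_le (h 0 0) (h 1 0)) (max_le (h 0 1) (h 1 1))
  have hcap : ccap κ Φ t p D g f c = max (c 0) (c 1) := min_eq_left hmax
  unfold cS; rw [hcap]
  fin_cases i
  · exact min_eq_left (le_max_left _ _)
  · exact min_eq_left (le_max_right _ _)

/-- **THE STAGGERED CELLS OF RECORD OF THE N2 CHAIN** (`PCells2S`): the cells `fcellsA` of the (ζ′) chain with the (truncated) creep `cS` toward the onward quadrant and the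
creep bound `ccap` — total in the slot value `c`. [cite: KozmaNitzan2024, §4 p. 25 (the renormalised lattice)] -/
def fcellsS : PCells2S where
  toPCells2 := fcellsA κ Φ t p D g f
  c := fun i => ((cS κ Φ t p D g f c i : ℕ) : ℤ)
  cmax := ccap κ Φ t p D g f c
  hc0 := fun i => Int.natCast_nonneg _
  hcm := fun i => by exact_mod_cast (cS_le κ Φ t p D g f c i).1
  hcr := fun j => ccap_le_r κ Φ t p D g f c j

/-- The underlying two-unit cells are `fcellsA` (by `rfl`): every number row of the (ζ′)/(ζ″) ledger about `K`, `s`, `r` carries. [folklore] -/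
@[simp] theorem fcellsS_toPCells2 : (fcellsS κ Φ t p D g f c).toPCells2 = fcellsA κ Φ t p D g f := rfl

/-- `r`, `s`, `K` of the staggered cells are `fcellsA`'s (by `rfl`). [folklore] -/
theorem fcellsS_r (i : Fin 2) : (fcellsS κ Φ t p D g f c).r i = (fcellsA κ Φ t p D g f).r i := rfl

/-- `s` of the staggered cells (by `rfl`). [folklore] -/
theorem fcellsS_s (i : Fin 2) : (fcellsS κ Φ t p D g f c).s i = (fcellsA κ Φ t p D g f).s i := rfl

/-- `K` of the staggered cells (by `rfl`). [folklore] -/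
theorem fcellsS_K : (fcellsS κ Φ t p D g f c).K = (fcellsA κ Φ t p D g f).K := rfl

/-- The creep field (by `rfl`). [folklore] -/
theorem fcellsS_c (i : Fin 2) : (fcellsS κ Φ t p D g f c).c i = ((cS κ Φ t p D g f c i : ℕ) : ℤ) := rfl

/-- The creep bound field (by `rfl`). [folklore] -/
theorem fcellsS_cmax : (fcellsS κ Φ t p D g f c).cmax = ccap κ Φ t p D g f c := rfl

/-- **`cmax ≤ r i`** (what the planar files read through `c_le_r/c_le_r_oth/sg_c_bound`). [folklore] -/
theorem fcellsS_cmax_le (i : Fin 2) : (fcellsS κ Φ t p D g f c).cmax ≤ (fcellsA κ Φ t p D g f).r i := ccap_le_r κ Φ t p D g f c i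

/-- The creep is at most the slot value. [folklore] -/
theorem fcellsS_c_le (i : Fin 2) : (fcellsS κ Φ t p D g f c).c i ≤ c i := by
  rw [fcellsS_c]; exact_mod_cast (cS_le κ Φ t p D g f c i).2

/-- **Under the ledger row `c i ≤ r j` the creep IS the slot value.** [folklore] -/
theorem fcellsS_c_eq (h : ∀ i j, c i ≤ (fcellsA κ Φ t p D g f).r j) (i : Fin 2) : (fcellsS κ Φ t p D g f c).c i = c i := by
  rw [fcellsS_c, cS_eq κ Φ t p D g f c h]

/-- With the zero slot value the staggered centre is the (ζ′) centre. [folklore] -/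
theorem fcellsS_cenS_zero (v : Site 2) : (fcellsS κ Φ t p D g f 0).cenS v = (fcellsA κ Φ t p D g f).cen v :=
  PCells2S.cenS_eq_cen_of_zero _ (fun i => by rw [fcellsS_c]; simp [cS]) v

/-! ## §2 The column slot at the staggered centre, the schedule, the arrival half-widths -/

/-- **The column slot of record, read at the STAGGERED centre**: `offNS x := NrepA (cenS x) + 1` (hp-8's `hcolQ` row `‖rep₂ (cenS x)‖₁ + 1 ≤ rQ a x`). [this work] -/
def offNS : Site 2 → ℕ := fun x => NrepA κ Φ t p D g f ((fcellsS κ Φ t p D g f c).cenS x) + 1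

/-- **The radius schedule of record over the staggered cells**: `schedOfS S := Prm.schedN S fcellsA offNS` (numbers over the underlying `PCells2`; the column slot at `cenS`).
[this work] -/
def schedOfS (S : Skelφ.Prm.SchedIn) : ConcRadiiG := Skelφ.Prm.schedN S (fcellsA κ Φ t p D g f) (offNS κ Φ t p D g f c)

/-- The schedule by name. [folklore] -/
theorem schedOfS_eq (S : Skelφ.Prm.SchedIn) : schedOfS κ Φ t p D g f c S = Skelφ.Prm.schedN S (fcellsA κ Φ t p D g f) (offNS κ Φ t p D g f c) := rfl

/-- **`WFS2 (fcellsS …).toPCells2 (schedOfS S)`** for every input block and every slot value. [this work] -/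
theorem schedOfS_WFS2 (S : Skelφ.Prm.SchedIn) : Skelφ.WFS2 (fcellsS κ Φ t p D g f c).toPCells2 (schedOfS κ Φ t p D g f c S) := Skelφ.Prm.schedN_WFS2 _ _ _

/-- **The column floor at the staggered centre**: `NrepA (cenS x) + 1 ≤ rQ a x`. [folklore] -/
theorem colQ_schedOfS (S : Skelφ.Prm.SchedIn) : ∀ a x, NrepA κ Φ t p D g f ((fcellsS κ Φ t p D g f c).cenS x) + 1 ≤ (schedOfS κ Φ t p D g f c S).rQ a x :=
  fun a x => Skelφ.Prm.off_le_schedN_rQ S (fcellsA κ Φ t p D g f) (offNS κ Φ t p D g f c) a x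

variable (b : Fin 2 → ℕ)

/-- **THE (TRUNCATED) ARRIVAL HALF-WIDTHS** (in fine cells): `bS i := min (b i) (3·r_i)` — total in the slot value; the truncation is inactive under the ledger row
`b_i ≤ 3·r_i`. [this work] -/
def bS : Fin 2 → ℕ := fun i => min (b i) (3 * (fcellsA κ Φ t p D g f).r i)

/-- **`bS i ≤ 3·r i`** (SmallMS's `Mb_subset_M` row `hb`), stated over the staggered cells, for EVERY slot value. [folklore] -/
theorem bS_le (i : Fin 2) : bS κ Φ t p D g f b i ≤ 3 * (fcellsS κ Φ t p D g f c).r i := by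
  rw [fcellsS_r]; exact min_le_right _ _

/-- `bS i ≤ b i`. [folklore] -/
theorem bS_le_slot (i : Fin 2) : bS κ Φ t p D g f b i ≤ b i := min_le_left _ _

/-- **Under the ledger row `b i ≤ 3·r i` the half-width IS the slot value.** [folklore] -/
theorem bS_eq (h : ∀ i, b i ≤ 3 * (fcellsA κ Φ t p D g f).r i) (i : Fin 2) : bS κ Φ t p D g f b i = b i := min_eq_left (h i)

/-! ## §3 The slot readings, the scheme of record, the choices, the choice function -/

variable (Pv : PSlot)

/-- **The extensible pair list**: `SMn ∪ extra`. [this work] -/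
def SMnP : Finset (ℕ × ℕ) := SMn κ Φ t p D g f ∪ (Pv κ Φ t p D).1

/-- The ledger pairs are listed. [folklore] -/
theorem SMn_subset_SMnP : SMn κ Φ t p D g f ⊆ SMnP κ Φ t p D g f Pv := Finset.subset_union_left

/-- The extra pairs are listed. [folklore] -/
theorem extra_subset_SMnP : (Pv κ Φ t p D).1 ⊆ SMnP κ Φ t p D g f Pv := Finset.subset_union_right

/-- **Pair admissibility of the extensible list.** [folklore] -/
theorem SMnP_adm_at : ∀ q ∈ SMnP κ Φ t p D g f Pv, D.M₀ ≤ q.1 ∧ D.n₁ q.1 ≤ q.2 := by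
  intro q hq
  rcases Finset.mem_union.1 hq with h | h
  · exact SMn_adm_at κ Φ t p D g f q h
  · exact (Pv κ Φ t p D).2 q h

variable (O : OutNS V) (gv fv : Neg.FSlot) (Sv : SSlot) (cv : CSlot) (bv : BSlot) (q : unitInterval)

/-- The box value at the merged record. [this work] -/
def gOf : ℕ := gv κ Φ t p O.merged

/-- The width value at the merged record. [this work] -/
def fOf : ℕ := fv κ Φ t p O.merged

/-- The creep value at the merged record (and the box/width values). [this work] -/
def cOf : Fin 2 → ℕ := cv κ Φ t p O.merged (gOf κ Φ t p O gv) (fOf κ Φ t p O fv)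

/-- The arrival half-widths at the merged record, TRUNCATED at `3r` (`bS`). [this work] -/
def bOf : Fin 2 → ℕ := bS κ Φ t p O.merged (gOf κ Φ t p O gv) (fOf κ Φ t p O fv) (bv κ Φ t p O.merged (gOf κ Φ t p O gv) (fOf κ Φ t p O fv))

/-- `bOf ≤ 3r` for every slot value. [folklore] -/
theorem bOf_le (i : Fin 2) :
    bOf κ Φ t p O gv fv bv i ≤ 3 * (fcellsS κ Φ t p O.merged (gOf κ Φ t p O gv) (fOf κ Φ t p O fv) (cOf κ Φ t p O gv fv cv)).r i :=
  bS_le κ Φ t p O.merged _ _ _ _ i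

/-- **THE SCHEME OF RECORD OF THE N2 CHAIN at `(O, q)`**: `cellGeomSG₂bS` over the oriented (ζ′) fine map `fineOA`, the STAGGERED cells `fcellsS`, root `t`, schedule
`schedOfS (Sv …)`, arrival boxes `bOf` (slot `bv`, truncated at `3r`). [cite: KozmaNitzan2024, §4 pp. 25–27 (Q_v, M_v, E_{v,x}, H^j_{v,x})] -/
def ΓQ : CellGeom V ℕ :=
  Skelφ.cellGeomSG₂bS G (fineOA κ Φ t p O.D O.DT.toDataN O.ori (gOf κ Φ t p O gv) (fOf κ Φ t p O fv))
    (fcellsS κ Φ t p O.merged (gOf κ Φ t p O gv) (fOf κ Φ t p O fv) (cOf κ Φ t p O gv fv cv)) t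
    (schedOfS κ Φ t p O.merged (gOf κ Φ t p O gv) (fOf κ Φ t p O fv) (cOf κ Φ t p O gv fv cv)
      (Sv κ Φ t p O.merged (gOf κ Φ t p O gv) (fOf κ Φ t p O fv) q))
    (bOf κ Φ t p O gv fv bv)

/-- **The face data of the N2 chain at `(O, q)`** (`faceDataSGS` over `fineOA`/`fcellsS`/`schedOfS`). [this work] -/
def FDQ : FaceData V ℕ :=
  Skelφ.faceDataSGS G (fineOA κ Φ t p O.D O.DT.toDataN O.ori (gOf κ Φ t p O gv) (fOf κ Φ t p O fv))
    (fcellsS κ Φ t p O.merged (gOf κ Φ t p O gv) (fOf κ Φ t p O fv) (cOf κ Φ t p O gv fv cv)) t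
    (schedOfS κ Φ t p O.merged (gOf κ Φ t p O gv) (fOf κ Φ t p O fv) (cOf κ Φ t p O gv fv cv)
      (Sv κ Φ t p O.merged (gOf κ Φ t p O gv) (fOf κ Φ t p O fv) q))

/-- **The level data of the N2 chain at `O`** (`levelDataSS` over `fineOA`/`fcellsS`). [this work] -/
def LDQ : LevelData V ℕ :=
  Skelφ.levelDataSS (fineOA κ Φ t p O.D O.DT.toDataN O.ori (gOf κ Φ t p O gv) (fOf κ Φ t p O fv))
    (fcellsS κ Φ t p O.merged (gOf κ Φ t p O gv) (fOf κ Φ t p O fv) (cOf κ Φ t p O gv fv cv))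

/-- The root of the scheme of record is `t` (by `rfl`). [folklore] -/
@[simp] theorem ΓQ_root : (ΓQ κ Φ t p O gv fv Sv cv bv q).root = t := rfl

/-- The base anchor of the scheme of record is `0` (by `rfl`). [folklore] -/
@[simp] theorem ΓQ_a₀ : (ΓQ κ Φ t p O gv fv Sv cv bv q).a₀ = 0 := rfl

/-- The number of stub levels of the scheme of record is the cells' `K` (by `rfl`). [folklore] -/
theorem ΓQ_K : (ΓQ κ Φ t p O gv fv Sv cv bv q).K = (fcellsA κ Φ t p O.merged (gOf κ Φ t p O gv) (fOf κ Φ t p O fv)).K := rfl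

/-- **The arrival box of the scheme of record** (what the (C) residue's `hlastM` and the (R) root leg read): the window span over the SMALL box `Mb bOf v` about the
staggered centre, radius `rM a v` of `schedOfS`. [folklore] -/
theorem ΓQ_M (a : ℕ) (v : Site 2) : (ΓQ κ Φ t p O gv fv Sv cv bv q).M a v =
    Skelφ.VWin G (fineOA κ Φ t p O.D O.DT.toDataN O.ori (gOf κ Φ t p O gv) (fOf κ Φ t p O fv)) t
      (PCells2S.Mb (fcellsS κ Φ t p O.merged (gOf κ Φ t p O gv) (fOf κ Φ t p O fv) (cOf κ Φ t p O gv fv cv)) (bOf κ Φ t p O gv fv bv) v)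
      ((schedOfS κ Φ t p O.merged (gOf κ Φ t p O gv) (fOf κ Φ t p O fv) (cOf κ Φ t p O gv fv cv)
        (Sv κ Φ t p O.merged (gOf κ Φ t p O gv) (fOf κ Φ t p O fv) q)).rM a v) := rfl

/-- **The cube of the scheme of record**: the window span over `Q v` about the staggered centre, radius `rQ a v`. [folklore] -/
theorem ΓQ_Q (a : ℕ) (v : Site 2) : (ΓQ κ Φ t p O gv fv Sv cv bv q).Q a v =
    Skelφ.VWin G (fineOA κ Φ t p O.D O.DT.toDataN O.ori (gOf κ Φ t p O gv) (fOf κ Φ t p O fv)) t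
      ((fcellsS κ Φ t p O.merged (gOf κ Φ t p O gv) (fOf κ Φ t p O fv) (cOf κ Φ t p O gv fv cv)).Q v)
      ((schedOfS κ Φ t p O.merged (gOf κ Φ t p O gv) (fOf κ Φ t p O fv) (cOf κ Φ t p O gv fv cv)
        (Sv κ Φ t p O.merged (gOf κ Φ t p O gv) (fOf κ Φ t p O fv) q)).rQ a v) := rfl

/-- The far region of the scheme of record: the window span over the slack two-block far region `FarNS₂ v δ` (the far block about the staggered NEIGHBOUR), radius
`rE a v δ`. [folklore] -/
theorem ΓQ_Efar (a : ℕ) (v : Site 2) (δ : MDir) : (ΓQ κ Φ t p O gv fv Sv cv bv q).Efar a v δ =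
    Skelφ.VWin G (fineOA κ Φ t p O.D O.DT.toDataN O.ori (gOf κ Φ t p O gv) (fOf κ Φ t p O fv)) t
      ((fcellsS κ Φ t p O.merged (gOf κ Φ t p O gv) (fOf κ Φ t p O fv) (cOf κ Φ t p O gv fv cv)).FarNS₂ v δ)
      ((schedOfS κ Φ t p O.merged (gOf κ Φ t p O gv) (fOf κ Φ t p O fv) (cOf κ Φ t p O gv fv cv)
        (Sv κ Φ t p O.merged (gOf κ Φ t p O gv) (fOf κ Φ t p O fv) q)).rE a v δ) := rfl

/-- The admissible anchors of the scheme of record are `{a, a+1}` (by `rfl`). [folklore] -/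
theorem ΓQ_anchSet (a : ℕ) (v : Site 2) : (ΓQ κ Φ t p O gv fv Sv cv bv q).anchSet a v = {a, a + 1} := rfl

variable (hC : Φ.CylSubcritical p)

/-- **THE N2 CHOICES at `(κ, Φ, t, p)` with the six slots** — `δI, m₀, Sz, SMn` as the record's (`SMnP` with the extra pairs), `Γ := ΓQ`, `FD := FDQ`, `LD := LDQ`.
[cite: KozmaNitzan2024, §4 Theorem 6 (pp. 25–31)] -/
def choiceAtQ : ChoiceNQ κ Φ t p hC where
  δI := Neg.δI κ Φ
  m₀ := Neg.m₀
  Sz := fun O => Neg.Sz O.merged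
  SMn := fun O => SMnP κ Φ t p O.merged (gOf κ Φ t p O gv) (fOf κ Φ t p O fv) Pv
  Γ := fun O q => ΓQ κ Φ t p O gv fv Sv cv bv q
  FD := fun O q => FDQ κ Φ t p O gv fv Sv cv q
  LD := fun O _ => LDQ κ Φ t p O gv fv cv
  δI_pos := Neg.δI_pos κ Φ
  δI_lt_one := Neg.δI_lt_one κ Φ
  S_adm := fun O _ => ⟨Neg.Sz_adm O.merged, SMnP_adm_at κ Φ t p O.merged _ _ Pv⟩

end Values

end NegB

/-- **THE CHOICE FUNCTION OF RECORD OF THE FRAMES-ONLY NODE, six slots** (box `gv`, width `fv`, extra pairs `Pv`, fibre block `Sv`, creep `cv`, arrival box `bv`):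
a `ChoiceFnNQ` over `κ : Consts` (the closure for it is p3-g15's `samePDropOfSkeletonFrm₁_of_choiceFnNQL`). [cite: KozmaNitzan2024, §4 Theorem 6 (pp. 25–31)] -/
def frmChoiceAllQ (gv fv : Neg.FSlot) (Pv : NegB.PSlot) (Sv : NegB.SSlot) (cv : NegB.CSlot) (bv : NegB.BSlot) : ChoiceFnNQ :=
  fun κ _ _ _ _ _ Φ _ t _ _ p _ _ hC => NegB.choiceAtQ κ Φ t p Pv gv fv Sv cv bv hC

/-- `frmChoiceAllQ` unfolds to `NegB.choiceAtQ` (by `rfl`). [folklore] -/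
theorem frmChoiceAllQ_eq (gv fv : Neg.FSlot) (Pv : NegB.PSlot) (Sv : NegB.SSlot) (cv : NegB.CSlot) (bv : NegB.BSlot) (κ : Consts) {V : Type} [DecidableEq V] [Countable V]
    (G : SimpleGraph V) [G.LocallyFinite] (Φ : PlanarSkeletonFrm G) (hg : ¬ HasExponentialGrowth G) (t : V) (ht : t ∈ Φ.types) (h1 : Φ.types = {t})
    (p : unitInterval) (hp0 : 0 < (p : ℝ)) (hp1 : (p : ℝ) < 1) (hC : Φ.CylSubcritical p) :
    frmChoiceAllQ gv fv Pv Sv cv bv κ G Φ hg t ht h1 p hp0 hp1 hC = NegB.choiceAtQ κ Φ t p Pv gv fv Sv cv bv hC := rfl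

/-- The scheme of the choice function of record at `(O, q)` is `⟨ΓQ, q, κ.δ⟩` (by `rfl`) — the form the (R)/(F)/(C) wrappers read. [folklore] -/
theorem frmChoiceAllQ_scheme (gv fv : Neg.FSlot) (Pv : NegB.PSlot) (Sv : NegB.SSlot) (cv : NegB.CSlot) (bv : NegB.BSlot) (κ : Consts) {V : Type} [DecidableEq V] [Countable V]
    (G : SimpleGraph V) [G.LocallyFinite] (Φ : PlanarSkeletonFrm G) (hg : ¬ HasExponentialGrowth G) (t : V) (ht : t ∈ Φ.types) (h1 : Φ.types = {t})
    (p : unitInterval) (hp0 : 0 < (p : ℝ)) (hp1 : (p : ℝ) < 1) (hC : Φ.CylSubcritical p) (O : Skelφ.StepI.OutNS V) (q : unitInterval) :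
    (frmChoiceAllQ gv fv Pv Sv cv bv κ G Φ hg t ht h1 p hp0 hp1 hC).scheme O q = ⟨NegB.ΓQ κ Φ t p O gv fv Sv cv bv q, q, κ.δ⟩ := rfl

end PlanarSkeletonFrm

end Summit.CriticalPhenomena.PercolationContinuityZ3.Theorems.Transplant

end
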